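import Summits.CriticalPhenomena.Ising3D.TaylorGerm
import Mathlib.Analysis.Normed.Ring.InfiniteSum
import Mathlib.Tactic.Linarith
import Mathlib.Tactic.Positivity
import Mathlib.Tactic.Ring
import Mathlib.Tactic.FieldSimp
import HarnessLib

/-!
# Taylor germs of double series `∑_{m,n} k_{mn} u_m(z) v_n(z̄)` (re-expansion lemma)
(cell `pub-ising3x`, seat boot-1; gate (g0) of the M3-γ milestone, part 3b)

HONEST FRAMING: lottery ticket; floor = tightest certified 3D Ising CFT bounds; no exact-solution
claim without a proof.

The conformal-block terms of the `σ–ε` sum rules are double series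
`F(z,z̄) = ∑_{(m,n)} k_{mn} u_m(z) v_n(z̄)` (`u_m(z) = (1-z)^s z^{τ+m}` etc.), each factor having a
one-variable Taylor germ at `x₀` resp. `y₀` (`TaylorGermOneVar.lean`) with a majorant of the shape
`A(t) X(t)^m` resp. `B(t) Y(t)^n`. This file proves the purely combinatorial-analytic step
(`hasTaylorGerm_doubleSum`): if `∑ |k_{mn}| X^m Y^n < ∞` then `F` has the Taylor germ
`T_{ab} = ∑_{(m,n)} k_{mn} c^{(m)}_a d^{(n)}_b` (`dsCoeff`) at `(x₀,y₀)`, with the majorant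
`∑_{ab} |T_{ab}| t^{a+b} ≤ A(t) B(t) ∑ |k_{mn}| X(t)^m Y(t)^n` — the input `HasSummableGerms` of
`TaylorFunctional.lean` wants, whose right-hand side is a block VALUE at a shifted real point when
`k ≥ 0` (part 3c). Proof: Fubini for the absolutely summable family on `(ℕ×ℕ) × (ℕ×ℕ)`
(`summable_prod_of_nonneg`, `HasSum.prod_fiberwise`), as in `hasTaylorGerm_of_majorant`.
Sources: elementary real analysis only.
-/

namespace Summit.CriticalPhenomena.Ising3D

open Finset

/-- The re-expanded coefficient array `T_{ab} = ∑_{(m,n)} k_{mn} c^{(m)}_a d^{(n)}_b`. [folklore] -/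
noncomputable def dsCoeff (k : ℕ × ℕ → ℝ) (c d : ℕ → ℕ → ℝ) (ab : ℕ × ℕ) : ℝ :=
  ∑' p : ℕ × ℕ, k p * c p.1 ab.1 * d p.2 ab.2

/-- The signed four-index family `k_{mn} (c^{(m)}_a h^a) (d^{(n)}_b h'^b)`. [folklore] -/
def dsFam (k : ℕ × ℕ → ℝ) (c d : ℕ → ℕ → ℝ) (h h' : ℝ) (q : (ℕ × ℕ) × (ℕ × ℕ)) : ℝ :=
  k q.1 * ((c q.1.1 q.2.1 * h ^ q.2.1) * (d q.1.2 q.2.2 * h' ^ q.2.2))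

/-- Its non-negative dominating family `|k_{mn}| (|c^{(m)}_a| t^a) (|d^{(n)}_b| t'^b)`. [folklore] -/
def dsDom (k : ℕ × ℕ → ℝ) (c d : ℕ → ℕ → ℝ) (t t' : ℝ) (q : (ℕ × ℕ) × (ℕ × ℕ)) : ℝ :=
  |k q.1| * ((|c q.1.1 q.2.1| * t ^ q.2.1) * (|d q.1.2 q.2.2| * t' ^ q.2.2))

section DoubleSum

variable {k : ℕ × ℕ → ℝ} {c d : ℕ → ℕ → ℝ} {u v : ℕ → ℝ → ℝ} {F : ℝ → ℝ → ℝ} {x₀ y₀ r : ℝ}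
  {A B X Y : ℝ → ℝ}

/-- A single coefficient of a one-variable germ is controlled by the majorant at any radius
`0 < t`: `|e_a| ≤ (∑ |e_i| t^i) / t^a`. [folklore] -/
theorem abs_coeff_le_tsum_div {e : ℕ → ℝ} {t : ℝ} (ht : 0 < t)
    (hs : Summable (fun i => |e i| * t ^ i)) (a : ℕ) :
    |e a| ≤ (∑' i, |e i| * t ^ i) / t ^ a := by
  rw [le_div_iff₀ (pow_pos ht a)]
  exact hs.le_tsum a fun j _ => by positivity

/-- The coefficient series `T_{ab}` converge absolutely (compare at the radius `r/2`).
[folklore] -/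
theorem summable_dsCoeff (hr : 0 < r)
    (hcu : ∀ (m : ℕ) (t : ℝ), 0 ≤ t → t < r →
      Summable (fun a => |c m a| * t ^ a) ∧ ∑' a, |c m a| * t ^ a ≤ A t * X t ^ m)
    (hdv : ∀ (n : ℕ) (t : ℝ), 0 ≤ t → t < r →
      Summable (fun b => |d n b| * t ^ b) ∧ ∑' b, |d n b| * t ^ b ≤ B t * Y t ^ n)
    (hk : ∀ t t', 0 ≤ t → t < r → 0 ≤ t' → t' < r →
      Summable (fun p : ℕ × ℕ => |k p| * X t ^ p.1 * Y t' ^ p.2)) (ab : ℕ × ℕ) :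
    Summable fun p : ℕ × ℕ => k p * c p.1 ab.1 * d p.2 ab.2 := by
  have hρ : 0 < r / 2 := by linarith
  have hρr : r / 2 < r := by linarith
  have hCX : ∀ m, |c m ab.1| ≤ A (r / 2) / (r / 2) ^ ab.1 * X (r / 2) ^ m := fun m => by
    refine (abs_coeff_le_tsum_div hρ (hcu m _ hρ.le hρr).1 ab.1).trans ?_
    rw [div_mul_eq_mul_div]
    exact div_le_div_of_nonneg_right (hcu m _ hρ.le hρr).2 (pow_nonneg hρ.le _)
  have hDY : ∀ n, |d n ab.2| ≤ B (r / 2) / (r / 2) ^ ab.2 * Y (r / 2) ^ n := fun n => by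
    refine (abs_coeff_le_tsum_div hρ (hdv n _ hρ.le hρr).1 ab.2).trans ?_
    rw [div_mul_eq_mul_div]
    exact div_le_div_of_nonneg_right (hdv n _ hρ.le hρr).2 (pow_nonneg hρ.le _)
  refine Summable.of_norm_bounded (g := fun p : ℕ × ℕ =>
    A (r / 2) / (r / 2) ^ ab.1 * (B (r / 2) / (r / 2) ^ ab.2) *
      (|k p| * X (r / 2) ^ p.1 * Y (r / 2) ^ p.2))
    ((hk _ _ hρ.le hρr hρ.le hρr).mul_left _) fun p => ?_
  rw [Real.norm_eq_abs, abs_mul, abs_mul]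
  have h1 := hCX p.1
  have h2 := hDY p.2
  have h0 : 0 ≤ A (r / 2) / (r / 2) ^ ab.1 * X (r / 2) ^ p.1 := le_trans (abs_nonneg _) h1
  calc |k p| * |c p.1 ab.1| * |d p.2 ab.2|
      ≤ |k p| * (A (r / 2) / (r / 2) ^ ab.1 * X (r / 2) ^ p.1) *
          (B (r / 2) / (r / 2) ^ ab.2 * Y (r / 2) ^ p.2) :=
        mul_le_mul (mul_le_mul_of_nonneg_left h1 (abs_nonneg _)) h2 (abs_nonneg _)
          (mul_nonneg (abs_nonneg _) h0)
    _ = _ := by ring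

/-- Row sums of the dominating family: `∑_{ab} dsDom (p,ab) = |k_p| (∑|c|t^a)(∑|d|t'^b)`.
[folklore] -/
theorem hasSum_dsDom_row {t t' : ℝ} (ht0 : 0 ≤ t) (ht : t < r) (ht'0 : 0 ≤ t') (ht' : t' < r)
    (hcu : ∀ (m : ℕ) (t : ℝ), 0 ≤ t → t < r →
      Summable (fun a => |c m a| * t ^ a) ∧ ∑' a, |c m a| * t ^ a ≤ A t * X t ^ m)
    (hdv : ∀ (n : ℕ) (t : ℝ), 0 ≤ t → t < r →
      Summable (fun b => |d n b| * t ^ b) ∧ ∑' b, |d n b| * t ^ b ≤ B t * Y t ^ n)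
    (p : ℕ × ℕ) :
    HasSum (fun ab : ℕ × ℕ => dsDom k c d t t' (p, ab))
      (|k p| * ((∑' a, |c p.1 a| * t ^ a) * ∑' b, |d p.2 b| * t' ^ b)) := by
  have hcn : Summable fun a => ‖|c p.1 a| * t ^ a‖ := by
    simpa only [Real.norm_eq_abs, abs_mul, abs_abs, abs_pow, abs_of_nonneg ht0]
      using (hcu p.1 t ht0 ht).1
  have hdn : Summable fun b => ‖|d p.2 b| * t' ^ b‖ := by
    simpa only [Real.norm_eq_abs, abs_mul, abs_abs, abs_pow, abs_of_nonneg ht'0]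
      using (hdv p.2 t' ht'0 ht').1
  exact ((hcu p.1 t ht0 ht).1.hasSum.mul (hdv p.2 t' ht'0 ht').1.hasSum
    (summable_mul_of_summable_norm hcn hdn)).mul_left (|k p|)

/-- The dominating family is summable, and its total is at most
`A(t) B(t') ∑ |k| X(t)^m Y(t')^n`. [folklore] -/
theorem summable_dsDom {t t' : ℝ} (ht0 : 0 ≤ t) (ht : t < r) (ht'0 : 0 ≤ t') (ht' : t' < r)
    (hcu : ∀ (m : ℕ) (t : ℝ), 0 ≤ t → t < r →
      Summable (fun a => |c m a| * t ^ a) ∧ ∑' a, |c m a| * t ^ a ≤ A t * X t ^ m)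
    (hdv : ∀ (n : ℕ) (t : ℝ), 0 ≤ t → t < r →
      Summable (fun b => |d n b| * t ^ b) ∧ ∑' b, |d n b| * t ^ b ≤ B t * Y t ^ n)
    (hk : ∀ t t', 0 ≤ t → t < r → 0 ≤ t' → t' < r →
      Summable (fun p : ℕ × ℕ => |k p| * X t ^ p.1 * Y t' ^ p.2)) :
    Summable (dsDom k c d t t') ∧
      ∑' q, dsDom k c d t t' q ≤ A t * B t' * ∑' p : ℕ × ℕ, |k p| * X t ^ p.1 * Y t' ^ p.2 := by
  have hrow := fun p => hasSum_dsDom_row (k := k) ht0 ht ht'0 ht' hcu hdv p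
  have hbound : ∀ p : ℕ × ℕ, |k p| * ((∑' a, |c p.1 a| * t ^ a) * ∑' b, |d p.2 b| * t' ^ b) ≤
      A t * B t' * (|k p| * X t ^ p.1 * Y t' ^ p.2) := fun p => by
    have h1 := (hcu p.1 t ht0 ht).2
    have h2 := (hdv p.2 t' ht'0 ht').2
    have h3 : 0 ≤ ∑' a, |c p.1 a| * t ^ a := tsum_nonneg fun a => by positivity
    have h4 : 0 ≤ ∑' b, |d p.2 b| * t' ^ b := tsum_nonneg fun b => by positivity
    calc |k p| * ((∑' a, |c p.1 a| * t ^ a) * ∑' b, |d p.2 b| * t' ^ b)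
        ≤ |k p| * ((A t * X t ^ p.1) * (B t' * Y t' ^ p.2)) :=
          mul_le_mul_of_nonneg_left (mul_le_mul h1 h2 h4 (le_trans h3 h1)) (abs_nonneg _)
      _ = _ := by ring
  have hg0 : 0 ≤ dsDom k c d t t' := fun q => by unfold dsDom; positivity
  have hmaj : Summable fun p : ℕ × ℕ => A t * B t' * (|k p| * X t ^ p.1 * Y t' ^ p.2) :=
    (hk t t' ht0 ht ht'0 ht').mul_left _
  have hsum : Summable (dsDom k c d t t') := by
    refine (summable_prod_of_nonneg hg0).mpr ⟨fun p => (hrow p).summable, ?_⟩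
    refine hmaj.of_nonneg_of_le (fun p => ?_) fun p => ?_
    · rw [(hrow p).tsum_eq]
      exact mul_nonneg (abs_nonneg _) (mul_nonneg (tsum_nonneg fun a => by positivity)
        (tsum_nonneg fun b => by positivity))
    · rw [(hrow p).tsum_eq]
      exact hbound p
  refine ⟨hsum, ?_⟩
  rw [hsum.tsum_prod, ← tsum_mul_left]
  refine Summable.tsum_le_tsum (fun p => ?_) (hsum.prod.congr fun p => rfl) hmaj
  rw [(hrow p).tsum_eq]
  exact hbound p

/-- The signed family is dominated by `dsDom` at `t = |h|`, `t' = |h'|`. [folklore] -/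
theorem norm_dsFam_le (h h' : ℝ) (q : (ℕ × ℕ) × (ℕ × ℕ)) :
    ‖dsFam k c d h h' q‖ ≤ dsDom k c d |h| |h'| q := by
  unfold dsFam dsDom
  rw [Real.norm_eq_abs, abs_mul, abs_mul, abs_mul, abs_mul, abs_pow, abs_pow]

/-- The signed family sums to `F(x₀+h, y₀+h')` (rows first). [folklore] -/
theorem hasSum_dsFam
    (hu : ∀ (m : ℕ) (h : ℝ), |h| < r → HasSum (fun a => c m a * h ^ a) (u m h))
    (hcu : ∀ (m : ℕ) (t : ℝ), 0 ≤ t → t < r →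
      Summable (fun a => |c m a| * t ^ a) ∧ ∑' a, |c m a| * t ^ a ≤ A t * X t ^ m)
    (hv : ∀ (n : ℕ) (h : ℝ), |h| < r → HasSum (fun b => d n b * h ^ b) (v n h))
    (hdv : ∀ (n : ℕ) (t : ℝ), 0 ≤ t → t < r →
      Summable (fun b => |d n b| * t ^ b) ∧ ∑' b, |d n b| * t ^ b ≤ B t * Y t ^ n)
    (hk : ∀ t t', 0 ≤ t → t < r → 0 ≤ t' → t' < r →
      Summable (fun p : ℕ × ℕ => |k p| * X t ^ p.1 * Y t' ^ p.2))
    (hF : ∀ h h', |h| < r → |h'| < r →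
      HasSum (fun p : ℕ × ℕ => k p * (u p.1 h * v p.2 h')) (F (x₀ + h) (y₀ + h')))
    {h h' : ℝ} (hh : |h| < r) (hh' : |h'| < r) :
    HasSum (dsFam k c d h h') (F (x₀ + h) (y₀ + h')) := by
  have ht0 : 0 ≤ |h| := abs_nonneg _
  have ht'0 : 0 ≤ |h'| := abs_nonneg _
  obtain ⟨hgsum, -⟩ := summable_dsDom (k := k) ht0 hh ht'0 hh' hcu hdv hk
  have hfsum : Summable (dsFam k c d h h') := Summable.of_norm_bounded hgsum (norm_dsFam_le h h')
  have hcn : ∀ m, Summable fun a => ‖c m a * h ^ a‖ := fun m => by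
    have h1 := (hcu m _ ht0 hh).1
    refine h1.congr fun a => ?_
    rw [Real.norm_eq_abs, abs_mul, abs_pow]
  have hdn : ∀ n, Summable fun b => ‖d n b * h' ^ b‖ := fun n => by
    have h1 := (hdv n _ ht'0 hh').1
    refine h1.congr fun b => ?_
    rw [Real.norm_eq_abs, abs_mul, abs_pow]
  have hfi : ∀ p : ℕ × ℕ, HasSum (fun ab : ℕ × ℕ => dsFam k c d h h' (p, ab))
      (k p * (u p.1 h * v p.2 h')) := fun p =>
    ((hu p.1 h hh).mul (hv p.2 h' hh') (summable_mul_of_summable_norm (hcn p.1) (hdn p.2))).mul_left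
      (k p)
  have h1 := hfsum.hasSum.prod_fiberwise hfi
  have heq : ∑' q, dsFam k c d h h' q = F (x₀ + h) (y₀ + h') := h1.unique (hF h h' hh hh')
  rw [← heq]
  exact hfsum.hasSum

/-- Column sums of the signed family: `∑_p dsFam (p, ab) = T_{ab} h^a h'^b`. [folklore] -/
theorem hasSum_dsFam_col (hr : 0 < r)
    (hcu : ∀ (m : ℕ) (t : ℝ), 0 ≤ t → t < r →
      Summable (fun a => |c m a| * t ^ a) ∧ ∑' a, |c m a| * t ^ a ≤ A t * X t ^ m)
    (hdv : ∀ (n : ℕ) (t : ℝ), 0 ≤ t → t < r →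
      Summable (fun b => |d n b| * t ^ b) ∧ ∑' b, |d n b| * t ^ b ≤ B t * Y t ^ n)
    (hk : ∀ t t', 0 ≤ t → t < r → 0 ≤ t' → t' < r →
      Summable (fun p : ℕ × ℕ => |k p| * X t ^ p.1 * Y t' ^ p.2))
    (h h' : ℝ) (ab : ℕ × ℕ) :
    HasSum (fun p : ℕ × ℕ => dsFam k c d h h' (p, ab))
      (dsCoeff k c d ab * h ^ ab.1 * h' ^ ab.2) := by
  have hcoef : Summable (fun p : ℕ × ℕ => k p * c p.1 ab.1 * d p.2 ab.2) :=
    summable_dsCoeff hr hcu hdv hk ab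
  refine ((hcoef.hasSum.mul_right (h ^ ab.1)).mul_right (h' ^ ab.2)).congr_fun fun p => ?_
  unfold dsFam
  ring

/-- One column of the absolute expansion is dominated by the column sum of `dsDom`. [folklore] -/
theorem abs_dsCoeff_mul_le (hr : 0 < r)
    (hcu : ∀ (m : ℕ) (t : ℝ), 0 ≤ t → t < r →
      Summable (fun a => |c m a| * t ^ a) ∧ ∑' a, |c m a| * t ^ a ≤ A t * X t ^ m)
    (hdv : ∀ (n : ℕ) (t : ℝ), 0 ≤ t → t < r →
      Summable (fun b => |d n b| * t ^ b) ∧ ∑' b, |d n b| * t ^ b ≤ B t * Y t ^ n)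
    (hk : ∀ t t', 0 ≤ t → t < r → 0 ≤ t' → t' < r →
      Summable (fun p : ℕ × ℕ => |k p| * X t ^ p.1 * Y t' ^ p.2))
    {t t' : ℝ} (ht0 : 0 ≤ t) (ht'0 : 0 ≤ t') (ab : ℕ × ℕ)
    (_hcol : Summable fun p : ℕ × ℕ => dsDom k c d t t' (p, ab)) :
    |dsCoeff k c d ab| * t ^ ab.1 * t' ^ ab.2 ≤ ∑' p : ℕ × ℕ, dsDom k c d t t' (p, ab) := by
  have hcoef : Summable (fun p : ℕ × ℕ => k p * c p.1 ab.1 * d p.2 ab.2) :=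
    summable_dsCoeff hr hcu hdv hk ab
  have hn : Summable fun p : ℕ × ℕ => ‖k p * c p.1 ab.1 * d p.2 ab.2‖ :=
    hcoef.abs.congr fun p => (Real.norm_eq_abs _).symm
  have h1 : |dsCoeff k c d ab| ≤ ∑' p : ℕ × ℕ, |k p * c p.1 ab.1 * d p.2 ab.2| := by
    have h2 := norm_tsum_le_tsum_norm hn
    simp only [Real.norm_eq_abs] at h2
    exact h2
  have h3 : (∑' p : ℕ × ℕ, |k p * c p.1 ab.1 * d p.2 ab.2|) * t ^ ab.1 * t' ^ ab.2 =
      ∑' p : ℕ × ℕ, dsDom k c d t t' (p, ab) := by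
    rw [← tsum_mul_right, ← tsum_mul_right]
    refine tsum_congr fun p => ?_
    unfold dsDom
    rw [abs_mul, abs_mul]
    ring
  rw [← h3]
  exact mul_le_mul_of_nonneg_right (mul_le_mul_of_nonneg_right h1 (pow_nonneg ht0 _))
    (pow_nonneg ht'0 _)

/-- **Re-expansion lemma (core, at one point).** For `|h|, |h'| < r`:
`∑_{ab} T_{ab} h^a h'^b = F(x₀+h, y₀+h')`, the expansion being absolutely summable with
`∑_{ab} |T_{ab}| |h|^a |h'|^b ≤ ∑ dsDom`. [folklore] -/
theorem hasSum_dsCoeff (hr : 0 < r)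
    (hu : ∀ (m : ℕ) (h : ℝ), |h| < r → HasSum (fun a => c m a * h ^ a) (u m h))
    (hcu : ∀ (m : ℕ) (t : ℝ), 0 ≤ t → t < r →
      Summable (fun a => |c m a| * t ^ a) ∧ ∑' a, |c m a| * t ^ a ≤ A t * X t ^ m)
    (hv : ∀ (n : ℕ) (h : ℝ), |h| < r → HasSum (fun b => d n b * h ^ b) (v n h))
    (hdv : ∀ (n : ℕ) (t : ℝ), 0 ≤ t → t < r →
      Summable (fun b => |d n b| * t ^ b) ∧ ∑' b, |d n b| * t ^ b ≤ B t * Y t ^ n)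
    (hk : ∀ t t', 0 ≤ t → t < r → 0 ≤ t' → t' < r →
      Summable (fun p : ℕ × ℕ => |k p| * X t ^ p.1 * Y t' ^ p.2))
    (hF : ∀ h h', |h| < r → |h'| < r →
      HasSum (fun p : ℕ × ℕ => k p * (u p.1 h * v p.2 h')) (F (x₀ + h) (y₀ + h')))
    {h h' : ℝ} (hh : |h| < r) (hh' : |h'| < r) :
    HasSum (fun ab : ℕ × ℕ => dsCoeff k c d ab * h ^ ab.1 * h' ^ ab.2) (F (x₀ + h) (y₀ + h')) ∧
    Summable (fun ab : ℕ × ℕ => |dsCoeff k c d ab| * |h| ^ ab.1 * |h'| ^ ab.2) ∧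
    ∑' ab : ℕ × ℕ, |dsCoeff k c d ab| * |h| ^ ab.1 * |h'| ^ ab.2 ≤
      ∑' q, dsDom k c d |h| |h'| q := by
  have ht0 : 0 ≤ |h| := abs_nonneg _
  have ht'0 : 0 ≤ |h'| := abs_nonneg _
  obtain ⟨hgsum, -⟩ := summable_dsDom (k := k) ht0 hh ht'0 hh' hcu hdv hk
  have hval := hasSum_dsFam hu hcu hv hdv hk hF hh hh'
  -- swap: columns
  have hswap : HasSum (fun q : (ℕ × ℕ) × (ℕ × ℕ) => dsFam k c d h h' q.swap)
      (F (x₀ + h) (y₀ + h')) := (Equiv.prodComm (ℕ × ℕ) (ℕ × ℕ)).hasSum_iff.mpr hval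
  have hmain : HasSum (fun ab : ℕ × ℕ => dsCoeff k c d ab * h ^ ab.1 * h' ^ ab.2)
      (F (x₀ + h) (y₀ + h')) :=
    hswap.prod_fiberwise fun ab => hasSum_dsFam_col hr hcu hdv hk h h' ab
  have hgswap : Summable fun q : (ℕ × ℕ) × (ℕ × ℕ) => dsDom k c d |h| |h'| q.swap :=
    hgsum.prod_symm
  have hgp : Summable fun ab : ℕ × ℕ => ∑' p : ℕ × ℕ, dsDom k c d |h| |h'| (p, ab) := hgswap.prod
  have hle : ∀ ab : ℕ × ℕ, |dsCoeff k c d ab| * |h| ^ ab.1 * |h'| ^ ab.2 ≤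
      ∑' p : ℕ × ℕ, dsDom k c d |h| |h'| (p, ab) := fun ab =>
    abs_dsCoeff_mul_le hr hcu hdv hk ht0 ht'0 ab (hgswap.prod_factor ab)
  have habs : Summable (fun ab : ℕ × ℕ => |dsCoeff k c d ab| * |h| ^ ab.1 * |h'| ^ ab.2) :=
    hgp.of_nonneg_of_le (fun ab => by positivity) hle
  have hsw : ∑' q : (ℕ × ℕ) × (ℕ × ℕ), dsDom k c d |h| |h'| q.swap = ∑' q, dsDom k c d |h| |h'| q :=
    (Equiv.prodComm (ℕ × ℕ) (ℕ × ℕ)).tsum_eq (dsDom k c d |h| |h'|)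
  refine ⟨hmain, habs, ?_⟩
  rw [← hsw, hgswap.tsum_prod]
  exact habs.tsum_le_tsum hle hgp

/-- **Re-expansion lemma.** `F(x₀+h, y₀+h') = ∑_{(m,n)} k_{mn} u_m(h) v_n(h')` on the square of
half-width `r`, the factors having one-variable germs `u_m(h) = ∑_a c^{(m)}_a h^a`,
`v_n(h') = ∑_b d^{(n)}_b h'^b` with majorants `∑_a |c^{(m)}_a| t^a ≤ A(t) X(t)^m`,
`∑_b |d^{(n)}_b| t^b ≤ B(t) Y(t)^n` and `∑ |k_{mn}| X(t)^m Y(t')^n < ∞` for all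
`0 ≤ t, t' < r`: then `F` has the Taylor germ `dsCoeff k c d` of radius `r` at `(x₀,y₀)`, with
`∑_{ab} |T_{ab}| t^{a+b} ≤ A(t) B(t) ∑ |k_{mn}| X(t)^m Y(t)^n` for every `0 ≤ t < r`. [folklore] -/
theorem hasTaylorGerm_doubleSum (hr : 0 < r)
    (hu : ∀ (m : ℕ) (h : ℝ), |h| < r → HasSum (fun a => c m a * h ^ a) (u m h))
    (hcu : ∀ (m : ℕ) (t : ℝ), 0 ≤ t → t < r →
      Summable (fun a => |c m a| * t ^ a) ∧ ∑' a, |c m a| * t ^ a ≤ A t * X t ^ m)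
    (hv : ∀ (n : ℕ) (h : ℝ), |h| < r → HasSum (fun b => d n b * h ^ b) (v n h))
    (hdv : ∀ (n : ℕ) (t : ℝ), 0 ≤ t → t < r →
      Summable (fun b => |d n b| * t ^ b) ∧ ∑' b, |d n b| * t ^ b ≤ B t * Y t ^ n)
    (hk : ∀ t t', 0 ≤ t → t < r → 0 ≤ t' → t' < r →
      Summable (fun p : ℕ × ℕ => |k p| * X t ^ p.1 * Y t' ^ p.2))
    (hF : ∀ h h', |h| < r → |h'| < r →
      HasSum (fun p : ℕ × ℕ => k p * (u p.1 h * v p.2 h')) (F (x₀ + h) (y₀ + h'))) :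
    HasTaylorGerm F x₀ y₀ r (dsCoeff k c d) ∧
      ∀ t, 0 ≤ t → t < r →
        Summable (fun ab : ℕ × ℕ => |dsCoeff k c d ab| * t ^ ab.1 * t ^ ab.2) ∧
        ∑' ab : ℕ × ℕ, |dsCoeff k c d ab| * t ^ ab.1 * t ^ ab.2 ≤
          A t * B t * ∑' p : ℕ × ℕ, |k p| * X t ^ p.1 * Y t ^ p.2 := by
  refine ⟨⟨hr, fun h h' hh hh' => ?_⟩, fun t ht0 htr => ?_⟩
  · obtain ⟨h1, h2, -⟩ := hasSum_dsCoeff hr hu hcu hv hdv hk hF hh hh'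
    exact ⟨h2, h1⟩
  · have ht : |t| < r := by rwa [abs_of_nonneg ht0]
    obtain ⟨-, h2, h3⟩ := hasSum_dsCoeff hr hu hcu hv hdv hk hF ht ht
    obtain ⟨-, h4⟩ := summable_dsDom (k := k) (abs_nonneg t) ht (abs_nonneg t) ht hcu hdv hk
    rw [abs_of_nonneg ht0] at h2 h3 h4
    exact ⟨h2, h3.trans h4⟩

end DoubleSum

end Summit.CriticalPhenomena.Ising3D
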